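import Literature.Probability.RandomPlanarGeometry.SlitCapacity
import HarnessLib

/-!
# Parametrization of a slit by half-plane capacity (Lawler's Remark 4.5)

G. F. Lawler, *Conformally Invariant Processes in the Plane*, AMS (2005), §4.1, Remark 4.5:
"Suppose `γ` is a curve as above and `b(t) = hcap[γ(0,t]]` … `b` is strictly increasing and
`b(t) - b(s) ≤ c diam(γ[0,t]) diam(γ[s,t])` if `s < t`; in particular, `b` is continuous.
Therefore, we can reparametrize `γ` by half-plane capacity, i.e., let `γ̃(t) = γ(b⁻¹(2t))`.
Then `γ̃` is a simple curve with `hcap[γ̃(0,t]] = 2t`." For a slit from a positive real point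
(`IsPlusSlit γ` on `[0, 1]`; `IsPlusSlit.cap = b`, `SlitCapacity`) this file PROVES the
continuity of `b` and constructs the time change and the objects of the chordal Loewner chain:

* `IsPlusSlit.continuousOn_cap` — **`b` is continuous on `[0, 1]`** (uniform local growth of the
  tip images, `SlitLanding`, and `b(v) - b(u) ≤ 288 ρ²`, `SlitCapacity`);
* `IsPlusSlit.capTime = S = b(1)/2` and `IsPlusSlit.timeChange = σ : [0, S] → [0, 1]`,
  `b(σ(t)) = 2t`, strictly increasing and continuous (`continuousOn_timeChange`);
* `IsPlusSlit.driveExt` — the driving function `U_u = g_u(γ u)` extended continuously to `[0, 1]`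
  (`U_0 = γ(0)`, `U_1 = lim_{u ↑ 1} U_u`; `continuousOn_driveExt`), and
  `IsPlusSlit.driving : ℝ≥0 → ℝ`, **the driving function `W_t = U_{σ(t)}` in capacity time**
  (continuous, `W_0 = γ(0)`, constant after `S`);
* `IsPlusSlit.flow t z = g_{σ(t)}(z)` — the candidate Loewner flow in capacity time.

## References

* G. F. Lawler (2005), §4.1, Remark 4.5, Lemma 4.2 [Lawler2005].
-/

noncomputable section

open Set Filter Metric Complex Bornology Function
open _root_.Topology
open UpperHalfPlane (upperHalfPlaneSet isOpen_upperHalfPlaneSet)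
open scoped NNReal

namespace Literature.Probability.RandomPlanarGeometry

namespace IsPlusSlit

variable {γ : ℝ → ℂ} (h : IsPlusSlit γ)

/-! ### Continuity of the capacity -/

/-- **Uniform right-increments of `b`**: for every `ε > 0` there is `δ > 0` with
`b(v) - b(u) ≤ ε` whenever `0 ≤ u ≤ v ≤ 1`, `v < u + δ` (at `u = 0`: `b(v) ≤ 288 osc²`; at `u > 0`:
`b(v) - b(u) ≤ 288 ρ²` with the uniform local growth). [cite: Lawler2005, Remark 4.5] -/
theorem exists_forall_cap_sub_cap_le {ε : ℝ} (hε : 0 < ε) :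
    ∃ δ : ℝ, 0 < δ ∧ ∀ u ∈ Icc (0 : ℝ) 1, ∀ v ∈ Icc (0 : ℝ) 1, u ≤ v → v < u + δ → h.cap v - h.cap u ≤ ε := by
  set ρ : ℝ := Real.sqrt (ε / 288) with hρ
  have hρpos : 0 < ρ := Real.sqrt_pos.2 (by positivity)
  have hρsq : 288 * ρ ^ 2 = ε := by
    rw [hρ, Real.sq_sqrt (by positivity)]; ring
  obtain ⟨δ₁, hδ₁, hgrowth⟩ := h.uniform_local_growth hρpos
  obtain ⟨δ₂, hδ₂, hγδ⟩ := h.exists_forall_norm_sub_lt hρpos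
  refine ⟨min δ₁ δ₂, lt_min hδ₁ hδ₂, fun u hu v hv huv hvδ ↦ ?_⟩
  rcases huv.eq_or_lt with rfl | hlt
  · simp [hε.le]
  rcases hu.1.eq_or_lt with heq | hu0
  · -- `u = 0`: `b(v) ≤ 288 ρ²`, the slit `γ[0, v]` lying in `B̄(γ(0), ρ)`
    rw [← heq, h.cap_zero, sub_zero]
    have hv0 : 0 < v := heq ▸ hlt
    have hsub : h.hull v ⊆ closedBall (((γ 0).re : ℝ) : ℂ) ρ := by
      rintro _ ⟨t, ht, rfl⟩
      rw [mem_closedBall, dist_eq_norm, h.ofReal_re_zero]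
      refine (hγδ t ⟨ht.1, ht.2.trans hv.2⟩ 0 ⟨le_rfl, zero_le_one⟩ ?_).le
      rw [sub_zero, abs_of_nonneg ht.1]
      have : v < δ₂ := by rw [← heq] at hvδ; linarith [min_le_right δ₁ δ₂]
      linarith [ht.2]
    exact (h.cap_le_of_subset hv0 hv.2 hρpos hsub).trans hρsq.le
  · rcases eq_or_lt_of_le hu.2 with hu1 | hu1
    · exact absurd (hu1 ▸ hlt) (not_lt.2 hv.2)
    refine (h.cap_sub_cap_le hu0 hu1 huv hv.2 hρpos fun t ht ↦ ?_).trans hρsq.le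
    exact hgrowth u hu0 hu1 t ht.1 (ht.2.trans hv.2) (lt_of_le_of_lt ht.2 (hvδ.trans_le (by linarith [min_le_left δ₁ δ₂])))

/-- **`b` is continuous on `[0, 1]`** (uniformly: `|b(v) - b(u)| ≤ ε` for `|v - u| < δ`). [cite: Lawler2005, Remark 4.5] -/
theorem continuousOn_cap : ContinuousOn h.cap (Icc 0 1) := by
  rw [Metric.continuousOn_iff]
  intro u hu ε hε
  obtain ⟨δ, hδ, hb⟩ := h.exists_forall_cap_sub_cap_le (half_pos hε)
  refine ⟨δ, hδ, fun v hv hvu ↦ ?_⟩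
  rw [Real.dist_eq] at hvu ⊢
  rcases le_total u v with huv | hvu'
  · have h1 := hb u hu v hv huv (by linarith [(abs_lt.1 hvu).2])
    have h2 : h.cap u ≤ h.cap v := h.strictMonoOn_cap.monotoneOn hu hv huv
    rw [abs_lt]; constructor <;> linarith
  · have h1 := hb v hv u hu hvu' (by linarith [(abs_lt.1 hvu).1])
    have h2 : h.cap v ≤ h.cap u := h.strictMonoOn_cap.monotoneOn hv hu hvu'
    rw [abs_lt]; constructor <;> linarith

/-! ### The time change `σ = b⁻¹(2·)` -/

/-- **The terminal capacity time `S = b(1)/2`.** [cite: Lawler2005, Remark 4.5] -/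
def capTime : ℝ := h.cap 1 / 2

/-- `0 < S`. [folklore] -/
theorem capTime_pos : 0 < h.capTime := by
  have := h.cap_pos one_pos le_rfl
  rw [capTime]; linarith

/-- Every value in `[0, b(1)]` is a capacity `b(u)`, `u ∈ [0, 1]`. [folklore] -/
theorem exists_cap_eq {y : ℝ} (hy : y ∈ Icc 0 (h.cap 1)) : ∃ u ∈ Icc (0 : ℝ) 1, h.cap u = y := by
  have := intermediate_value_Icc zero_le_one h.continuousOn_cap
  rw [h.cap_zero] at this
  exact this hy

/-- **The time change `σ(t) = b⁻¹(2t)`** (a choice of preimage in `[0, 1]`; meaningful for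
`t ∈ [0, S]`). [cite: Lawler2005, Remark 4.5 (γ̃(t) = γ(b⁻¹(2t)))] -/
def timeChange (t : ℝ) : ℝ := Function.invFunOn h.cap (Icc 0 1) (2 * t)

/-- `σ(t) ∈ [0, 1]` and `b(σ(t)) = 2t` for `t ∈ [0, S]`. [folklore] -/
theorem timeChange_spec {t : ℝ} (ht : t ∈ Icc 0 h.capTime) :
    h.timeChange t ∈ Icc (0 : ℝ) 1 ∧ h.cap (h.timeChange t) = 2 * t := by
  have hy : 2 * t ∈ Icc 0 (h.cap 1) := by
    constructor
    · linarith [ht.1]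
    · have := ht.2; rw [capTime] at this; linarith
  exact Function.invFunOn_pos (h.exists_cap_eq hy)

/-- `σ(t) ∈ [0, 1]`. [folklore] -/
theorem timeChange_mem {t : ℝ} (ht : t ∈ Icc 0 h.capTime) : h.timeChange t ∈ Icc (0 : ℝ) 1 :=
  (h.timeChange_spec ht).1

/-- `b(σ(t)) = 2t`. [folklore] -/
theorem cap_timeChange {t : ℝ} (ht : t ∈ Icc 0 h.capTime) : h.cap (h.timeChange t) = 2 * t :=
  (h.timeChange_spec ht).2

/-- `σ(b(u)/2) = u` for `u ∈ [0, 1]`. [folklore] -/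
theorem timeChange_cap_div_two {u : ℝ} (hu : u ∈ Icc (0 : ℝ) 1) : h.timeChange (h.cap u / 2) = u := by
  have ht : h.cap u / 2 ∈ Icc 0 h.capTime := by
    refine ⟨by linarith [h.cap_nonneg hu.1 hu.2], ?_⟩
    rw [capTime]
    linarith [h.strictMonoOn_cap.monotoneOn hu ⟨zero_le_one, le_rfl⟩ hu.2]
  refine h.strictMonoOn_cap.injOn (h.timeChange_mem ht) hu ?_
  rw [h.cap_timeChange ht]; ring

/-- `σ(0) = 0`. [folklore] -/
theorem timeChange_zero : h.timeChange 0 = 0 := by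
  have := h.timeChange_cap_div_two ⟨le_rfl, zero_le_one⟩
  rwa [h.cap_zero, zero_div] at this

/-- `σ(S) = 1`. [folklore] -/
theorem timeChange_capTime : h.timeChange h.capTime = 1 := by
  have := h.timeChange_cap_div_two ⟨zero_le_one, le_rfl⟩
  rwa [show h.cap 1 / 2 = h.capTime from rfl] at this

/-- **`σ` is strictly increasing on `[0, S]`.** [folklore] -/
theorem strictMonoOn_timeChange : StrictMonoOn h.timeChange (Icc 0 h.capTime) := by
  intro t ht t' ht' htt'
  rw [← h.strictMonoOn_cap.lt_iff_lt (h.timeChange_mem ht) (h.timeChange_mem ht'), h.cap_timeChange ht,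
    h.cap_timeChange ht']
  linarith

/-- `0 < σ(t)` for `0 < t ≤ S`. [folklore] -/
theorem timeChange_pos {t : ℝ} (ht0 : 0 < t) (htS : t ≤ h.capTime) : 0 < h.timeChange t := by
  have := h.strictMonoOn_timeChange ⟨le_rfl, h.capTime_pos.le⟩ ⟨ht0.le, htS⟩ ht0
  rwa [h.timeChange_zero] at this

/-- `σ(t) < 1` for `0 ≤ t < S`. [folklore] -/
theorem timeChange_lt_one {t : ℝ} (ht0 : 0 ≤ t) (htS : t < h.capTime) : h.timeChange t < 1 := by
  have := h.strictMonoOn_timeChange ⟨ht0, htS.le⟩ ⟨h.capTime_pos.le, le_rfl⟩ htS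
  rwa [h.timeChange_capTime] at this

/-- **Inverse modulus of `b`**: for `ε > 0` there is `η > 0` such that `|b(u) - b(u')| < η` forces
`|u - u'| ≤ ε` on `[0, 1]` (strict monotonicity and continuity on a compact interval). [folklore] -/
theorem exists_forall_abs_sub_le_of_cap {ε : ℝ} (hε : 0 < ε) :
    ∃ η : ℝ, 0 < η ∧ ∀ u ∈ Icc (0 : ℝ) 1, ∀ u' ∈ Icc (0 : ℝ) 1, |h.cap u - h.cap u'| < η → |u - u'| ≤ ε := by
  rcases le_or_gt 1 ε with hε1 | hε1
  · refine ⟨1, one_pos, fun u hu u' hu' _ ↦ ?_⟩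
    rw [abs_le]; constructor <;> linarith [hu.1, hu.2, hu'.1, hu'.2]
  -- the minimal increment of `b` over windows of length `ε`
  have hK : IsCompact (Icc (0 : ℝ) (1 - ε)) := isCompact_Icc
  have hD : ContinuousOn (fun w ↦ h.cap (w + ε) - h.cap w) (Icc 0 (1 - ε)) := by
    refine (h.continuousOn_cap.comp (f := fun w : ℝ ↦ w + ε) (by fun_prop) ?_).sub
      (h.continuousOn_cap.mono fun w hw ↦ ⟨hw.1, by linarith [hw.2]⟩)
    intro w hw
    exact ⟨by simp only; linarith [hw.1], by simp only; linarith [hw.2]⟩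
  obtain ⟨w₀, hw₀, hmin⟩ := hK.exists_isMinOn ⟨0, ⟨le_rfl, by linarith⟩⟩ hD
  set m : ℝ := h.cap (w₀ + ε) - h.cap w₀ with hm
  have hmpos : 0 < m := by
    have := h.strictMonoOn_cap ⟨hw₀.1, by linarith [hw₀.2]⟩ ⟨by linarith [hw₀.1], by linarith [hw₀.2]⟩
      (show w₀ < w₀ + ε by linarith)
    rw [hm]; linarith
  refine ⟨m, hmpos, fun u hu u' hu' hlt ↦ ?_⟩
  by_contra hcon
  push Not at hcon
  -- WLOG `u < u'` with `u' - u > ε`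
  wlog huu' : u ≤ u' generalizing u u'
  · exact this u' hu' u hu (by rwa [abs_sub_comm]) (by rwa [abs_sub_comm]) (le_of_not_ge huu')
  have hgap : u + ε < u' := by
    rw [abs_of_nonpos (by linarith)] at hcon; linarith
  have huw : u ∈ Icc 0 (1 - ε) := ⟨hu.1, by linarith [hu'.2]⟩
  have h1 : m ≤ h.cap (u + ε) - h.cap u := hmin huw
  have h2 : h.cap (u + ε) < h.cap u' :=
    h.strictMonoOn_cap ⟨by linarith [hu.1], by linarith [hu'.2]⟩ hu' hgap
  have h3 : h.cap u ≤ h.cap u' := h.strictMonoOn_cap.monotoneOn hu hu' huu'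
  rw [abs_of_nonpos (by linarith)] at hlt
  linarith

/-- **`σ` is uniformly continuous on `[0, S]`.** [folklore] -/
theorem exists_forall_abs_timeChange_sub_le {ε : ℝ} (hε : 0 < ε) :
    ∃ η : ℝ, 0 < η ∧ ∀ t ∈ Icc 0 h.capTime, ∀ t' ∈ Icc 0 h.capTime, |t - t'| < η →
      |h.timeChange t - h.timeChange t'| ≤ ε := by
  obtain ⟨η, hη, hmod⟩ := h.exists_forall_abs_sub_le_of_cap hε
  refine ⟨η / 2, half_pos hη, fun t ht t' ht' htt' ↦ hmod _ (h.timeChange_mem ht) _ (h.timeChange_mem ht') ?_⟩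
  rw [h.cap_timeChange ht, h.cap_timeChange ht', ← mul_sub, abs_mul, abs_two]
  linarith

/-- **`σ` is continuous on `[0, S]`.** [cite: Lawler2005, Remark 4.5] -/
theorem continuousOn_timeChange : ContinuousOn h.timeChange (Icc 0 h.capTime) := by
  rw [Metric.continuousOn_iff]
  intro t ht ε hε
  obtain ⟨η, hη, hmod⟩ := h.exists_forall_abs_timeChange_sub_le (half_pos hε)
  refine ⟨η, hη, fun t' ht' htt' ↦ ?_⟩
  rw [Real.dist_eq] at htt' ⊢
  exact (hmod t' ht' t ht htt').trans_lt (half_lt_self hε)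

/-! ### The driving function on `[0, 1]` and in capacity time -/

/-- `u ↦ U_u` is continuous at every point of `(0, 1)`. [cite: Lawler2005, Lemma 4.2] -/
theorem continuousAt_drive {u : ℝ} (hu0 : 0 < u) (hu1 : u < 1) : ContinuousAt h.drive u := by
  rw [Metric.continuousAt_iff]
  intro ε hε
  obtain ⟨δ, hδ, hmod⟩ := h.uniformContinuous_drive (half_pos hε)
  refine ⟨min δ (min u (1 - u)), lt_min hδ (lt_min hu0 (by linarith)), fun v hv ↦ ?_⟩
  rw [Real.dist_eq] at hv ⊢
  have hvδ : |v - u| < δ := hv.trans_le (min_le_left _ _)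
  have hv0 : 0 < v := by
    have := hv.trans_le ((min_le_right _ _).trans (min_le_left _ _))
    rw [abs_lt] at this; linarith
  have hv1 : v < 1 := by
    have := hv.trans_le ((min_le_right _ _).trans (min_le_right _ _))
    rw [abs_lt] at this; linarith
  rcases lt_trichotomy u v with huv | rfl | hvu
  · have := hmod u v hu0 huv hv1 (by linarith [(abs_lt.1 hvδ).2])
    exact this.trans_lt (half_lt_self hε)
  · simp [hε]
  · have := hmod v u hv0 hvu hu1 (by linarith [(abs_lt.1 hvδ).1])
    rw [abs_sub_comm]
    exact this.trans_lt (half_lt_self hε)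

/-- The left limit `U_{1-} = lim_{u ↑ 1} U_u` exists (Cauchy, by uniform continuity). [folklore] -/
theorem exists_tendsto_drive_one : ∃ d : ℝ, Tendsto h.drive (𝓝[<] 1) (𝓝 d) := by
  have hC : Cauchy (map h.drive (𝓝[<] (1 : ℝ))) := by
    rw [Metric.cauchy_iff]
    refine ⟨inferInstance, fun ε hε ↦ ?_⟩
    obtain ⟨δ, hδ, hmod⟩ := h.uniformContinuous_drive (half_pos hε)
    have hmem : Ioo (1 - min δ 1) 1 ∈ 𝓝[<] (1 : ℝ) := Ioo_mem_nhdsLT (by linarith [lt_min hδ one_pos])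
    refine ⟨h.drive '' Ioo (1 - min δ 1) 1, image_mem_map hmem, ?_⟩
    rintro _ ⟨u, hu, rfl⟩ _ ⟨v, hv, rfl⟩
    have hu0 : 0 < u := by linarith [hu.1, min_le_right δ 1]
    have hv0 : 0 < v := by linarith [hv.1, min_le_right δ 1]
    rw [Real.dist_eq]
    rcases lt_trichotomy u v with huv | rfl | hvu
    · rw [abs_sub_comm]
      exact (hmod u v hu0 huv hv.2 (by linarith [hu.1, hv.2, min_le_left δ 1])).trans_lt (half_lt_self hε)
    · simp [hε]
    · exact (hmod v u hv0 hvu hu.2 (by linarith [hv.1, hu.2, min_le_left δ 1])).trans_lt (half_lt_self hε)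
  obtain ⟨d, hd⟩ := CompleteSpace.complete hC
  exact ⟨d, hd⟩

/-- **The driving function `u ↦ U_u` on `[0, 1]`**: `U_0 = γ(0)`, `U_u = g_u(γ u)` on `(0, 1)`,
`U_1 = U_{1-}`. [cite: Lawler2005, Lemma 4.2] -/
def driveExt (u : ℝ) : ℝ :=
  if u ≤ 0 then (γ 0).re else if u < 1 then h.drive u else Classical.choose h.exists_tendsto_drive_one

/-- `driveExt = drive` on `(0, 1)`. [folklore] -/
theorem driveExt_of_mem {u : ℝ} (hu : u ∈ Ioo (0 : ℝ) 1) : h.driveExt u = h.drive u := by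
  simp [driveExt, not_le.2 hu.1, hu.2]

/-- `driveExt 0 = γ(0)`. [folklore] -/
@[simp] theorem driveExt_zero : h.driveExt 0 = (γ 0).re := by simp [driveExt]

/-- **`u ↦ U_u` is continuous on `[0, 1]`.** [cite: Lawler2005, Lemma 4.2] -/
theorem continuousOn_driveExt : ContinuousOn h.driveExt (Icc 0 1) := by
  intro u hu
  rcases hu.1.eq_or_lt with heq | hu0
  · -- at `0`: `|U_u - γ(0)| ≤ 19 osc → 0`
    rw [← heq]
    refine (continuousWithinAt_Icc_iff_Ici zero_lt_one).2 (continuousWithinAt_Ioi_iff_Ici.1 ?_)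
    rw [ContinuousWithinAt, h.driveExt_zero, Metric.tendsto_nhdsWithin_nhds]
    intro ε hε
    obtain ⟨δ, hδ, hγδ⟩ := h.exists_forall_norm_sub_lt (show 0 < ε / 20 by positivity)
    refine ⟨min δ 1, lt_min hδ one_pos, fun v hv hvd ↦ ?_⟩
    rw [Real.dist_eq, sub_zero] at hvd
    have hv0 : 0 < v := hv
    have hvabs : |v| = v := abs_of_pos hv0
    rw [hvabs] at hvd
    have hv1 : v < 1 := hvd.trans_le (min_le_right _ _)
    rw [Real.dist_eq, h.driveExt_of_mem ⟨hv0, hv1⟩]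
    have key := h.abs_drive_sub_re_zero_le hv0 hv1 (show 0 < ε / 20 by positivity) fun t ht ↦
      (hγδ t ⟨ht.1, ht.2.trans hv1.le⟩ 0 ⟨le_rfl, zero_le_one⟩ (by
        rw [sub_zero, abs_of_nonneg ht.1]; exact ht.2.trans_lt (hvd.trans_le (min_le_left _ _)))).le
    linarith
  rcases eq_or_lt_of_le hu.2 with hu1 | hu1
  · -- at `1`: the left limit
    rw [hu1]
    refine (continuousWithinAt_Icc_iff_Iic zero_lt_one).2 (continuousWithinAt_Iio_iff_Iic.1 ?_)
    have hspec := Classical.choose_spec h.exists_tendsto_drive_one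
    have hval : h.driveExt 1 = Classical.choose h.exists_tendsto_drive_one := by simp [driveExt]
    rw [ContinuousWithinAt, hval]
    refine hspec.congr' ?_
    filter_upwards [Ioo_mem_nhdsLT zero_lt_one] with v hv using (h.driveExt_of_mem hv).symm
  · -- interior
    have hc := h.continuousAt_drive hu0 hu1
    have heq : h.driveExt =ᶠ[𝓝 u] h.drive :=
      eventuallyEq_of_mem (Ioo_mem_nhds hu0 hu1) fun v hv ↦ h.driveExt_of_mem hv
    exact (hc.congr heq.symm).continuousWithinAt


/-- **The driving function in capacity time, `W_t = U_{σ(t)}`** (`t ∈ [0, S]`; constant after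
`S`), as a function on `ℝ≥0` (the tree's driving functions). [cite: Lawler2005, Prop. 4.4 (U_t) with Remark 4.5] -/
def driving (t : ℝ≥0) : ℝ := h.driveExt (h.timeChange (min (t : ℝ) h.capTime))

/-- `W` is continuous. [cite: Lawler2005, Lemma 4.2 with Remark 4.5] -/
theorem continuous_driving : Continuous h.driving := by
  have h1 : Continuous fun t : ℝ≥0 ↦ min (t : ℝ) h.capTime := continuous_subtype_val.min continuous_const
  have hmem : ∀ t : ℝ≥0, min (t : ℝ) h.capTime ∈ Icc 0 h.capTime := fun t ↦
    ⟨le_min t.2 h.capTime_pos.le, min_le_right _ _⟩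
  have h2 : Continuous fun t : ℝ≥0 ↦ h.timeChange (min (t : ℝ) h.capTime) :=
    h.continuousOn_timeChange.comp_continuous h1 hmem
  exact h.continuousOn_driveExt.comp_continuous h2 fun t ↦ h.timeChange_mem (hmem t)

/-- `W_0 = γ(0)`. [folklore] -/
theorem driving_zero : h.driving 0 = (γ 0).re := by
  simp [driving, min_eq_left h.capTime_pos.le, h.timeChange_zero]

/-- `0 < W_0`. [folklore] -/
theorem driving_zero_pos : 0 < h.driving 0 := by rw [h.driving_zero]; exact h.re_pos

/-- `W_t = U_{σ(t)}` for `t ∈ (0, S)`. [folklore] -/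
theorem driving_eq {t : ℝ≥0} (ht0 : 0 < (t : ℝ)) (htS : (t : ℝ) < h.capTime) :
    h.driving t = h.drive (h.timeChange t) := by
  rw [driving, min_eq_left htS.le, h.driveExt_of_mem ⟨h.timeChange_pos ht0 htS.le, h.timeChange_lt_one ht0.le htS⟩]

/-- For a real time `t ∈ (0, S)`: `W_{t⁺} = U_{σ(t)}`. [folklore] -/
theorem driving_toNNReal {t : ℝ} (ht0 : 0 < t) (htS : t < h.capTime) :
    h.driving t.toNNReal = h.drive (h.timeChange t) := by
  have : ((t.toNNReal : ℝ≥0) : ℝ) = t := Real.coe_toNNReal _ ht0.le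
  rw [h.driving_eq (by rw [this]; exact ht0) (by rw [this]; exact htS), this]

/-- **The candidate Loewner flow in capacity time, `g_{σ(t)}(z)`** (`z` for `t ≤ 0`, frozen after
`S`). [cite: Lawler2005, Prop. 4.4] -/
def flow (t : ℝ) (z : ℂ) : ℂ :=
  if ht : 0 < t ∧ t ≤ h.capTime then
    h.gmap (u := h.timeChange t) (h.timeChange_pos ht.1 ht.2) (h.timeChange_mem ⟨ht.1.le, ht.2⟩).2 z
  else z

/-- `flow 0 z = z`. [folklore] -/
@[simp] theorem flow_zero (z : ℂ) : h.flow 0 z = z := by simp [flow]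

/-- `flow t z = g_{σ(t)}(z)` for `t ∈ (0, S]` (junk `z` after `S`). [folklore] -/
theorem flow_eq {t : ℝ} (ht0 : 0 < t) (htS : t ≤ h.capTime) (z : ℂ) :
    h.flow t z = h.gmap (u := h.timeChange t) (h.timeChange_pos ht0 htS) (h.timeChange_mem ⟨ht0.le, htS⟩).2 z := by
  simp only [flow, dif_pos (And.intro ht0 htS)]

end IsPlusSlit

end Literature.Probability.RandomPlanarGeometry
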